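import Summits.AnomalousDissipation.AnomalousDissipation.Theorems.ScalarAnomalySteadySourceFormal.Negative.CellFlux
import Summits.AnomalousDissipation.AnomalousDissipation.Theorems.ScalarAnomalySteadySourceFormal.Negative.ShearLimit

/-!
# Negative knowledge for the crux `ScalarAnomalySteadySourceFormal` (stmt-AnomalousDissipation-0448), VIII-b:
# the square-band inequality along the weak solution (general band-limited stirring)

Certified copy of §10.2 of the cdisprove work file: the analogue of `Negative.ShearLimit.band_modes_le`
for square bands and general band-limited stirring `S ⊆ {|k 0| ≤ R, |k 1| ≤ R}`
(`cell_band_modes_le`):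
`2ν ∫_{(0,T)} bandDiss (sbox K' \\ sbox K) y ≤ ‖θ₀‖² + 8π #S M ((K+R) ∫ innerSqLayerSum + (K'+R) ∫ outerSqLayerSum) + 2 η ∫‖θ‖`,
plus the square-layer counting lemma (`sum_Ico_slayerSum_le`: each mode lies in at most `2R` square
layers) and its two integrated pigeonholes (`exists_slayer_small` — plain, for the inner layers;
`exists_slayer_small_tail` — against the spectral TAIL of the variance, for the outer ones).

Supports stmt-AnomalousDissipation-0448 (the band-limited no-go, files `Cell*`).
-/

set_option linter.dupNamespace false

noncomputable section

open scoped BigOperators Topology ENNReal NNReal InnerProductSpace ContDiff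
open Filter Set Function MeasureTheory UnitAddTorus Complex

namespace Summit.AnomalousDissipation.AnomalousDissipation.Theorems.ScalarAnomalySteadySourceFormal.Negative

open Literature.Analysis
open Literature.Analysis.FunctionSpaces Literature.Analysis.FunctionSpaces.Torus
open Literature.Analysis.FluidPDE Literature.Analysis.FluidPDE.Torus

/-- The frequency lattice `ℤ²` (local notation). -/
local notation "ℤ²" => Fin 2 → ℤ

section CellBand

variable {ν : ℝ} {S : Finset ℤ²} {R : ℕ} {M : ℝ} {c : ℝ → ℤ² → EuclideanSpace ℂ (Fin 2)}
  {u : ℝ → UnitAddTorus (Fin 2) → EuclideanSpace ℝ (Fin 2)} {h θ₀ : UnitAddTorus (Fin 2) → ℝ}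
  {θ : ℝ → UnitAddTorus (Fin 2) → ℝ}

/-- **The square-band inequality along the weak solution** (general band-limited stirring). [folklore] -/
theorem cell_band_modes_le (hw : IsWeakScalarTransportForced ν u (fun _ => h) θ₀ θ)
    (hu : ∀ s, u s = realTrigPoly S (c s)) (hh : Integrable h volume) (hθ₀ : MemLp θ₀ 2 volume)
    (hc : ∀ k, Continuous fun s => c s k) (hM : ∀ s k, ‖c s k‖ ≤ M) (hM0 : 0 ≤ M)
    (htrans : ∀ s, ∀ k ∈ S, zdot k (c s k) = 0) (hS : ∀ k ∈ S, |k 0| ≤ R ∧ |k 1| ≤ R)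
    {K K' : ℤ} (hK : 0 ≤ K) (hK' : 0 ≤ K') {T : ℝ} (hT : 0 < T) :
    2 * ν * ∫ t in Ioo 0 T, bandDiss (box K' K' \ box K K) (modes θ t) ≤
      scalarL2Sq θ₀ +
        8 * Real.pi * S.card * M * ((K + R) * (∫ t in Ioo 0 T, slayerSum (K - R) (K + R) (modes θ t)) +
          (K' + R) * ∫ t in Ioo 0 T, slayerSum (K' - R) (K' + R) (modes θ t)) +
        2 * sourceMass (box K' K' \ box K K) h * ∫ t in Ioo 0 T, Real.sqrt (scalarL2Sq (θ t)) := by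
  classical
  set 𝔅 := box K' K' \ box K K with h𝔅
  have hθ₀i : Integrable θ₀ volume := hθ₀.integrable one_le_two
  have hband := band_dissipation_le hw hu hh hθ₀i hc hM htrans hT 𝔅
  rw [intervalIntegral_cmodes_eq hw hu hh hθ₀i hT (fun _ Y => bandDiss 𝔅 Y),
    intervalIntegral_cmodes_eq hw hu hh hθ₀i hT (fun t Y => ‖bdryFlux S 𝔅 (c t) Y‖),
    intervalIntegral_cmodes_eq hw hu hh hθ₀i hT (fun _ Y => ‖sourcePairing 𝔅 h Y‖)] at hband
  have h0 : bandEnergy 𝔅 (fun p => mFourierCoeff (fun x => (θ₀ x : ℂ)) p) ≤ scalarL2Sq θ₀ :=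
    sum_sq_norm_mFourierCoeff_le_integral_sq hθ₀ 𝔅
  have hwT := hw T hT
  have hR0 : (0 : ℝ) ≤ R := by exact_mod_cast R.zero_le
  have hflux : ∫ t in Ioo 0 T, ‖bdryFlux S 𝔅 (c t) (modes θ t)‖ ≤
      4 * S.card * M * ((K + R) * (∫ t in Ioo 0 T, slayerSum (K - R) (K + R) (modes θ t)) +
        (K' + R) * ∫ t in Ioo 0 T, slayerSum (K' - R) (K' + R) (modes θ t)) := by
    have hiG : IntegrableOn (fun t => slayerSum (K - R) (K + R) (modes θ t)) (Ioo 0 T) volume := by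
      simpa [slayerSum] using forced_integrableOn_sum_sq_modes hwT (slayer (K - R) (K + R)) (fun _ => 1)
    have hiO : IntegrableOn (fun t => slayerSum (K' - R) (K' + R) (modes θ t)) (Ioo 0 T) volume := by
      simpa [slayerSum] using forced_integrableOn_sum_sq_modes hwT (slayer (K' - R) (K' + R)) (fun _ => 1)
    have hiF : IntegrableOn (fun t => ‖bdryFlux S 𝔅 (c t) (modes θ t)‖) (Ioo 0 T) volume :=
      integrableOn_comp_modes hw hu hh hθ₀i hT (fun t Y => ‖bdryFlux S 𝔅 (c t) Y‖)
        (continuousOn_bdryFlux hw hc hM hT 𝔅).norm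
    calc ∫ t in Ioo 0 T, ‖bdryFlux S 𝔅 (c t) (modes θ t)‖
        ≤ ∫ t in Ioo 0 T, 4 * S.card * M * ((K + R) * slayerSum (K - R) (K + R) (modes θ t) +
            (K' + R) * slayerSum (K' - R) (K' + R) (modes θ t)) := by
          refine integral_mono_ae hiF (((hiG.const_mul _).add (hiO.const_mul _)).const_mul _)
            (Eventually.of_forall fun t => ?_)
          exact norm_bdryFlux_cell_le hK hK' hS (hM t) hM0 (modes θ t)
      _ = 4 * S.card * M * ((K + R) * (∫ t in Ioo 0 T, slayerSum (K - R) (K + R) (modes θ t)) +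
            (K' + R) * ∫ t in Ioo 0 T, slayerSum (K' - R) (K' + R) (modes θ t)) := by
          rw [integral_const_mul, integral_add (hiG.const_mul _) (hiO.const_mul _), integral_const_mul,
            integral_const_mul]
  have hsrc : ∫ t in Ioo 0 T, ‖sourcePairing 𝔅 h (modes θ t)‖ ≤
      sourceMass 𝔅 h * ∫ t in Ioo 0 T, Real.sqrt (scalarL2Sq (θ t)) := by
    have hiP : IntegrableOn (fun t => ‖sourcePairing 𝔅 h (modes θ t)‖) (Ioo 0 T) volume :=
      integrableOn_comp_modes hw hu hh hθ₀i hT (fun _ Y => ‖sourcePairing 𝔅 h Y‖)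
        (continuousOn_sourcePairing hw hc hM hT 𝔅).norm
    rw [← integral_const_mul]
    refine integral_mono_ae hiP ((forced_integrableOn_sqrt_scalarL2Sq hwT).const_mul _) ?_
    filter_upwards [forced_ae_sum_sq_modes_le hwT 𝔅] with t ht
    refine (norm_sourcePairing_le 𝔅 h (modes θ t)).trans ?_
    exact mul_le_mul_of_nonneg_left (Real.sqrt_le_sqrt ht) (sourceMass_nonneg _ _)
  have hπ := Real.pi_pos
  have hsm := sourceMass_nonneg 𝔅 h
  have hG0 : 0 ≤ ∫ t in Ioo 0 T, slayerSum (K - R) (K + R) (modes θ t) :=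
    setIntegral_nonneg measurableSet_Ioo fun _ _ => slayerSum_nonneg _ _ _
  have hO0 : 0 ≤ ∫ t in Ioo 0 T, slayerSum (K' - R) (K' + R) (modes θ t) :=
    setIntegral_nonneg measurableSet_Ioo fun _ _ => slayerSum_nonneg _ _ _
  calc 2 * ν * ∫ t in Ioo 0 T, bandDiss 𝔅 (modes θ t)
      ≤ bandEnergy 𝔅 (fun p => mFourierCoeff (fun x => (θ₀ x : ℂ)) p) +
          2 * Real.pi * (∫ t in Ioo 0 T, ‖bdryFlux S 𝔅 (c t) (modes θ t)‖) +
          2 * ∫ t in Ioo 0 T, ‖sourcePairing 𝔅 h (modes θ t)‖ := hband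
    _ ≤ scalarL2Sq θ₀ + 2 * Real.pi * (4 * S.card * M * ((K + R) * (∫ t in Ioo 0 T, slayerSum (K - R) (K + R) (modes θ t)) +
          (K' + R) * ∫ t in Ioo 0 T, slayerSum (K' - R) (K' + R) (modes θ t))) +
          2 * (sourceMass 𝔅 h * ∫ t in Ioo 0 T, Real.sqrt (scalarL2Sq (θ t))) := by
        gcongr
    _ = _ := by ring

end CellBand

section CellCounting

/-- **Each mode lies in at most `2R` consecutive square layers**: for `a ≥ R`,
`∑_{K∈[a,a+N)} slayerSum (K-R) (K+R) Y ≤ 2R ∑_{p ∈ box (a+N+R) (a+N+R), a-R < |p|_∞} ‖Y p‖²`. [folklore] -/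
theorem sum_Ico_slayerSum_le (R : ℕ) (a : ℤ) (N : ℕ) (Y : ℤ² → ℂ) :
    ∑ K ∈ Finset.Ico a (a + N), slayerSum (K - R) (K + R) Y ≤ 2 * R * ∑ p ∈ slayer (a - R) (a + N + R), ‖Y p‖ ^ 2 := by
  classical
  set U := slayer (a - R) (a + N + R) with hU
  have hsub : ∀ K ∈ Finset.Ico a (a + N), slayer (K - R) (K + R) ⊆ U := by
    intro K hK p hp
    rw [Finset.mem_Ico] at hK
    rw [mem_slayer] at hp
    rw [hU, mem_slayer]
    refine ⟨⟨by omega, by omega⟩, ?_⟩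
    rcases hp.2 with h | h
    · left; omega
    · right; omega
  have e1 : ∀ K ∈ Finset.Ico a (a + N), slayerSum (K - R) (K + R) Y =
      ∑ p ∈ U, if p ∈ slayer (K - R) (K + R) then ‖Y p‖ ^ 2 else 0 := by
    intro K hK
    rw [slayerSum, ← Finset.sum_filter]
    congr 1
    ext p
    simp only [Finset.mem_filter]
    exact ⟨fun hp => ⟨hsub K hK hp, hp⟩, fun hp => hp.2⟩
  rw [Finset.sum_congr rfl e1, Finset.sum_comm, Finset.mul_sum]
  refine Finset.sum_le_sum fun p _ => ?_
  rw [← Finset.sum_filter, Finset.sum_const, nsmul_eq_mul]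
  refine mul_le_mul_of_nonneg_right ?_ (sq_nonneg _)
  have hcard : ((Finset.Ico a (a + N)).filter fun K => p ∈ slayer (K - R) (K + R)) ⊆
      Finset.Ico (max |p 0| |p 1| - R) (max |p 0| |p 1| + R) := by
    intro K hK
    simp only [Finset.mem_filter, mem_slayer, Finset.mem_Ico] at hK ⊢
    obtain ⟨_, ⟨h0, h1⟩, hor⟩ := hK
    constructor
    · rcases le_total |p 0| |p 1| with h | h
      · rw [max_eq_right h]; omega
      · rw [max_eq_left h]; omega
    · rcases le_total |p 0| |p 1| with h | h
      · rw [max_eq_right h]; rcases hor with h' | h' <;> omega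
      · rw [max_eq_left h]; rcases hor with h' | h' <;> omega
  calc (((Finset.Ico a (a + N)).filter fun K => p ∈ slayer (K - R) (K + R)).card : ℝ)
      ≤ (Finset.Ico (max |p 0| |p 1| - R) (max |p 0| |p 1| + R)).card := by exact_mod_cast Finset.card_le_card hcard
    _ = 2 * R := by
        rw [Int.card_Ico]
        have : max |p 0| |p 1| + R - (max |p 0| |p 1| - R) = 2 * R := by ring
        rw [this]
        norm_cast

variable {ν : ℝ} {u : ℝ → UnitAddTorus (Fin 2) → EuclideanSpace ℝ (Fin 2)} {h θ₀ : UnitAddTorus (Fin 2) → ℝ}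
  {θ : ℝ → UnitAddTorus (Fin 2) → ℝ}

/-- **Square-layer pigeonhole** (plain): among `N ≥ 1` consecutive square layers `K ∈ [a, a+N)` one
carries at most `2R ∫‖θ‖² / N`. [folklore] -/
theorem exists_slayer_small (hw : IsWeakScalarTransportForced ν u (fun _ => h) θ₀ θ) {R : ℕ} {T : ℝ} (hT : 0 < T)
    (a : ℤ) {N : ℕ} (hN : 1 ≤ N) :
    ∃ K ∈ Finset.Ico a (a + N), ∫ t in Ioo 0 T, slayerSum (K - R) (K + R) (modes θ t) ≤
      2 * R * (∫ t in Ioo 0 T, scalarL2Sq (θ t)) / N := by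
  classical
  have hwT := hw T hT
  set I := Finset.Ico a (a + N) with hI
  have hIcard : I.card = N := by rw [hI, Int.card_Ico]; omega
  have hIne : I.Nonempty := by rw [← Finset.card_pos, hIcard]; omega
  have hint : ∀ K ∈ I, IntegrableOn (fun t => slayerSum (K - R) (K + R) (modes θ t)) (Ioo 0 T) volume := by
    intro K _
    simpa [slayerSum] using forced_integrableOn_sum_sq_modes hwT (slayer (K - R) (K + R)) (fun _ => 1)
  have hsum : ∑ K ∈ I, ∫ t in Ioo 0 T, slayerSum (K - R) (K + R) (modes θ t) ≤
      2 * R * ∫ t in Ioo 0 T, scalarL2Sq (θ t) := by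
    rw [← integral_finsetSum _ hint, ← integral_const_mul]
    refine integral_mono_ae (integrable_finsetSum _ hint) ((forced_integrableOn_scalarL2Sq hwT).const_mul _) ?_
    filter_upwards [forced_ae_sum_sq_modes_le hwT (slayer (a - R) (a + N + R))] with t ht
    calc ∑ K ∈ I, slayerSum (K - R) (K + R) (modes θ t)
        ≤ 2 * R * ∑ p ∈ slayer (a - R) (a + N + R), ‖modes θ t p‖ ^ 2 := sum_Ico_slayerSum_le R a N (modes θ t)
      _ ≤ 2 * R * scalarL2Sq (θ t) := by gcongr
  have hsum' : ∑ K ∈ I, ∫ t in Ioo 0 T, slayerSum (K - R) (K + R) (modes θ t) ≤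
      ∑ K ∈ I, 2 * R * (∫ t in Ioo 0 T, scalarL2Sq (θ t)) / N := by
    rw [Finset.sum_const, hIcard, nsmul_eq_mul]
    have hNpos : (0 : ℝ) < N := by exact_mod_cast hN
    calc _ ≤ 2 * R * ∫ t in Ioo 0 T, scalarL2Sq (θ t) := hsum
      _ = N * (2 * R * (∫ t in Ioo 0 T, scalarL2Sq (θ t)) / N) := by field_simp
  exact Finset.exists_le_of_sum_le hIne hsum'

/-- The spectral tail of the variance beyond the square box `sbox L`: `‖θ(t)‖² - ∑_{p ∈ sbox L} ‖y_p(t)‖²`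
(nonnegative for a.e. `t` by Bessel). [folklore] -/
def sqTail (θ : ℝ → UnitAddTorus (Fin 2) → ℝ) (L : ℤ) (t : ℝ) : ℝ :=
  scalarL2Sq (θ t) - ∑ p ∈ box L L, ‖modes θ t p‖ ^ 2

/-- **Square-layer pigeonhole against the tail**: among the square layers `K' ∈ [a, a+N)` (`N ≥ 1`,
`R ≤ a`) one satisfies `∫ slayerSum (K'-R) (K'+R) ≤ 2R ∫ sqTail (a - R) / N`. [folklore] -/
theorem exists_slayer_small_tail (hw : IsWeakScalarTransportForced ν u (fun _ => h) θ₀ θ) {R : ℕ} {T : ℝ} (hT : 0 < T)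
    (a : ℤ) {N : ℕ} (hN : 1 ≤ N) :
    ∃ K' ∈ Finset.Ico a (a + N), ∫ t in Ioo 0 T, slayerSum (K' - R) (K' + R) (modes θ t) ≤
      2 * R * (∫ t in Ioo 0 T, sqTail θ (a - R) t) / N := by
  classical
  have hwT := hw T hT
  set I := Finset.Ico a (a + N) with hI
  have hIcard : I.card = N := by rw [hI, Int.card_Ico]; omega
  have hIne : I.Nonempty := by rw [← Finset.card_pos, hIcard]; omega
  have hint : ∀ K ∈ I, IntegrableOn (fun t => slayerSum (K - R) (K + R) (modes θ t)) (Ioo 0 T) volume := by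
    intro K _
    simpa [slayerSum] using forced_integrableOn_sum_sq_modes hwT (slayer (K - R) (K + R)) (fun _ => 1)
  have hiTail : IntegrableOn (fun t => sqTail θ (a - R) t) (Ioo 0 T) volume := by
    unfold sqTail
    exact (forced_integrableOn_scalarL2Sq hwT).sub (integrable_finsetSum _ fun p _ => forced_integrableOn_sq_modes hwT p)
  -- disjointness of the inner box and the union of layers
  have hdisj : Disjoint (box (a - R) (a - R)) (slayer (a - R) (a + N + R)) := by
    rw [Finset.disjoint_left]
    intro p hp hp'
    rw [mem_box] at hp
    rw [mem_slayer] at hp'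
    rcases hp'.2 with h | h <;> omega
  have hsum : ∑ K ∈ I, ∫ t in Ioo 0 T, slayerSum (K - R) (K + R) (modes θ t) ≤
      2 * R * ∫ t in Ioo 0 T, sqTail θ (a - R) t := by
    rw [← integral_finsetSum _ hint, ← integral_const_mul]
    refine integral_mono_ae (integrable_finsetSum _ hint) (hiTail.const_mul _) ?_
    filter_upwards [forced_ae_sum_sq_modes_le hwT (box (a - R) (a - R) ∪ slayer (a - R) (a + N + R))] with t ht
    rw [Finset.sum_union hdisj] at ht
    have htail : ∑ p ∈ slayer (a - R) (a + N + R), ‖modes θ t p‖ ^ 2 ≤ sqTail θ (a - R) t := by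
      unfold sqTail; linarith
    calc ∑ K ∈ I, slayerSum (K - R) (K + R) (modes θ t)
        ≤ 2 * R * ∑ p ∈ slayer (a - R) (a + N + R), ‖modes θ t p‖ ^ 2 := sum_Ico_slayerSum_le R a N (modes θ t)
      _ ≤ 2 * R * sqTail θ (a - R) t := by gcongr
  have hsum' : ∑ K ∈ I, ∫ t in Ioo 0 T, slayerSum (K - R) (K + R) (modes θ t) ≤
      ∑ K ∈ I, 2 * R * (∫ t in Ioo 0 T, sqTail θ (a - R) t) / N := by
    rw [Finset.sum_const, hIcard, nsmul_eq_mul]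
    have hNpos : (0 : ℝ) < N := by exact_mod_cast hN
    calc _ ≤ 2 * R * ∫ t in Ioo 0 T, sqTail θ (a - R) t := hsum
      _ = N * (2 * R * (∫ t in Ioo 0 T, sqTail θ (a - R) t) / N) := by field_simp
  exact Finset.exists_le_of_sum_le hIne hsum'

end CellCounting

end Summit.AnomalousDissipation.AnomalousDissipation.Theorems.ScalarAnomalySteadySourceFormal.Negative
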